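import Literature.Probability.RandomPlanarGeometry.RadialBesselMarkovKernel
import Literature.Probability.RandomPlanarGeometry.RadialBesselLyapunov
import Literature.Probability.Process.KrylovBogoliubov
import HarnessLib

/-!
# The invariant probability measure of the SLE_κ radial Bessel process, `κ ≤ 4`: existence and uniqueness

Topic `Probability/RandomPlanarGeometry`; four auxiliary definitions with bodies (`angleRetract`,
`AngleState`, `angleProj`, `angleKernel`) and proved theorems (no named fact). For `0 < κ ≤ 4` the
SLE_κ radial Bessel process `dY = cot(Y/2) dt - √κ dB` on `(0, 2π)` (LSW (2002), (2.11); Lawler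
(2005), (1.16)) — the angle process of radial / whole-plane SLE_κ(0), generator
`L₀ = (κ/2)∂² + cot(·/2)∂ = angleGenerator κ 0` — has transition kernels `sleKernel κ t`
(`RadialBesselMarkovKernel`). We prove:

* `exists_invariant_sleKernel` — **existence of an invariant probability measure** `μ` on `ℝ`,
  carried by `(0, 2π)`, with `μ P_t = μ` for all `t ≥ 0`: the Krylov–Bogoliubov theorem of the
  tree (`MarkovSemigroup.exists_invariant_of_bounded_orbit`, Da Prato–Zabczyk (1996), Thm 3.1.1)
  on the state space `(0, 2π)` (where the kernels are Feller, `tendsto_integral_sleArg`), with the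
  coercive Lyapunov function `V = (1 - log sin(y/2))^{1/2}` and its uniform moment bound
  `lintegral_sqrtLyap_sleArg_le` (tightness inside the open interval);
* `invariant_sleKernel_unique` — **uniqueness**: two invariant probability measures carried by
  `(0, 2π)` coincide, by the synchronous-coupling contraction
  `|P_t g(θ) - P_t g(θ')| ≤ L|θ - θ'| e^{-t/2}` (`abs_integral_sleArg_sub_le`) and `t → ∞`.

This is the one-dimensional-marginal half of Miller–Sheffield (2013), Prop. 2.1 (existence and
uniqueness of the stationary SLE_κ(ρ) angle law), for `ρ = 0`, `κ ≤ 4` — to which the general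
non-hitting case reduces by time scaling (`IsStationaryAngleLaw.exists_unique_of_rho_zero`).

## References

* J. Miller, S. Sheffield, *Imaginary geometry IV*, PTRF 169 (2017), arXiv:1302.4738, §2.1.2,
  Prop. 2.1. [MillerSheffield2013]
* G. Da Prato, J. Zabczyk, *Ergodicity for infinite-dimensional systems* (1996), Thm 3.1.1.
  [DapratoZabczyk1996]
* G. F. Lawler, *Conformally Invariant Processes in the Plane*, AMS (2005), §1.11. [Lawler2005]
-/

noncomputable section

open MeasureTheory ProbabilityTheory Filter Topology Set
open scoped NNReal ENNReal BoundedContinuousFunction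

namespace Literature.Probability.RandomPlanarGeometry

namespace RadialLoewner

open Literature.Probability.Process

/-! ### The state space `(0, 2π)` and the retraction onto it -/

section State

/-- **Retraction of `ℝ` onto `(0, 2π)`**: the identity on `(0, 2π)`, the value `π` outside (a
measurable device to read the junk branch of the flow inside the state space). [folklore] -/
def angleRetract (y : ℝ) : ℝ := if y ∈ Ioo 0 (2 * Real.pi) then y else Real.pi

/-- `π ∈ (0, 2π)` (a private copy of `RadialBesselHarmonic`'s lemma, to keep imports light).
[folklore] -/
private theorem pi_mem_Ioo_twoPi : Real.pi ∈ Ioo 0 (2 * Real.pi) :=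
  ⟨Real.pi_pos, by linarith [Real.pi_pos]⟩

/-- The retraction takes values in `(0, 2π)`. [folklore] -/
theorem angleRetract_mem (y : ℝ) : angleRetract y ∈ Ioo 0 (2 * Real.pi) := by
  unfold angleRetract
  split_ifs with h
  · exact h
  · exact pi_mem_Ioo_twoPi

/-- The retraction is the identity on `(0, 2π)`. [folklore] -/
theorem angleRetract_of_mem {y : ℝ} (h : y ∈ Ioo 0 (2 * Real.pi)) : angleRetract y = y := by
  unfold angleRetract; rw [if_pos h]

/-- The retraction is measurable. [folklore] -/
theorem measurable_angleRetract : Measurable angleRetract :=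
  Measurable.ite measurableSet_Ioo measurable_id measurable_const

/-- **The state space** `(0, 2π)` of the angle process, as a type. [folklore] -/
abbrev AngleState : Type := Ioo (0 : ℝ) (2 * Real.pi)

/-- The retraction read in the state space. [folklore] -/
def angleProj (y : ℝ) : AngleState := ⟨angleRetract y, angleRetract_mem y⟩

/-- Value of the projection. [folklore] -/
@[simp] theorem angleProj_val (y : ℝ) : (angleProj y : ℝ) = angleRetract y := rfl

/-- The projection is a left inverse of the inclusion. [folklore] -/
@[simp] theorem angleProj_coe (x : AngleState) : angleProj (x : ℝ) = x :=
  Subtype.ext (angleRetract_of_mem x.2)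

/-- The projection is measurable. [folklore] -/
theorem measurable_angleProj : Measurable angleProj := measurable_angleRetract.subtype_mk

/-- A function on the state space, read on `ℝ` through the projection, is continuous on `(0, 2π)`
when it is continuous. [folklore] -/
theorem continuousOn_comp_angleProj {β : Type*} [TopologicalSpace β] {g : AngleState → β}
    (hg : Continuous g) : ContinuousOn (g ∘ angleProj) (Ioo 0 (2 * Real.pi)) := by
  rw [continuousOn_iff_continuous_restrict]
  have : (Ioo 0 (2 * Real.pi)).restrict (g ∘ angleProj) = g := by
    funext x; simp [Set.restrict]
  rw [this]; exact hg

/-- A measure carried by `(0, 2π)` is invariant under the retraction. [folklore] -/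
theorem map_angleRetract_eq_self {μ : Measure ℝ} (h : ∀ᵐ y ∂μ, y ∈ Ioo 0 (2 * Real.pi)) :
    μ.map angleRetract = μ := by
  have : angleRetract =ᵐ[μ] id := h.mono fun y hy ↦ angleRetract_of_mem hy
  rw [Measure.map_congr this, Measure.map_id]

end State

/-! ### The transition kernels on the state space -/

section Kernels

variable (κ : ℝ≥0)

/-- **The transition kernels of the SLE_κ radial Bessel process on the state space `(0, 2π)`**:
`sleKernel κ t` restricted to starts in `(0, 2π)` and read through the retraction (which is the
identity almost surely, `sleKernel_apply_Ioo`). [folklore] -/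
def angleKernel (t : ℝ≥0) : Kernel AngleState AngleState :=
  ((sleKernel κ t).comap Subtype.val measurable_subtype_coe).map angleProj

/-- The state-space kernel at `x` is the image of `P_t(x, ·)` under the projection. [folklore] -/
theorem angleKernel_apply (t : ℝ≥0) (x : AngleState) :
    angleKernel κ t x = (sleKernel κ t (x : ℝ)).map angleProj := by
  rw [angleKernel, Kernel.map_apply _ measurable_angleProj, Kernel.comap_apply]

/-- The state-space kernels are Markov kernels. [folklore] -/
instance isMarkovKernel_angleKernel (t : ℝ≥0) : IsMarkovKernel (angleKernel κ t) :=
  ⟨fun x ↦ by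
    rw [angleKernel_apply]
    exact Measure.isProbabilityMeasure_map measurable_angleProj.aemeasurable⟩

variable {κ}

/-- For `κ ≤ 4` the law `P_t(θ, ·)`, `θ ∈ (0, 2π)`, is carried by `(0, 2π)`. [folklore] -/
theorem ae_sleKernel_mem_Ioo (hκ : κ ≤ 4) {θ : ℝ} (hθ : θ ∈ Ioo 0 (2 * Real.pi)) (t : ℝ≥0) :
    ∀ᵐ y ∂(sleKernel κ t θ), y ∈ Ioo 0 (2 * Real.pi) := by
  haveI : IsProbabilityMeasure (sleKernel κ t θ) := IsMarkovKernel.isProbabilityMeasure θ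
  rw [ae_iff, ← compl_setOf, show {y : ℝ | y ∈ Ioo 0 (2 * Real.pi)} = Ioo 0 (2 * Real.pi) from rfl,
    prob_compl_eq_zero_iff measurableSet_Ioo]
  exact sleKernel_apply_Ioo hκ hθ t

/-- Reading the state-space kernel back on `ℝ`: `(angleKernel κ t x) ∘ val⁻¹ = P_t(x, ·)`.
[folklore] -/
theorem map_val_angleKernel (hκ : κ ≤ 4) (t : ℝ≥0) (x : AngleState) :
    (angleKernel κ t x).map Subtype.val = sleKernel κ t (x : ℝ) := by
  rw [angleKernel_apply, Measure.map_map measurable_subtype_coe measurable_angleProj]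
  exact map_angleRetract_eq_self (ae_sleKernel_mem_Ioo hκ x.2 t)

/-- `bind` after `map`: `(μ ∘ f⁻¹) P = μ (P ∘ f)`. [folklore] -/
theorem bind_map_left {α β γ : Type*} [MeasurableSpace α] [MeasurableSpace β] [MeasurableSpace γ]
    {μ : Measure α} {f : α → β} (hf : Measurable f) (k : Kernel β γ) :
    (μ.map f).bind k = μ.bind (fun a ↦ k (f a)) := by
  ext s hs
  rw [Measure.bind_apply hs k.aemeasurable, lintegral_map (k.measurable_coe hs) hf,
    Measure.bind_apply (f := fun a ↦ k (f a)) hs ((k.measurable.comp hf).aemeasurable)]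

/-- `map` after `bind`: `(μ P) ∘ f⁻¹ = μ (P ∘ f⁻¹)`. [folklore] -/
theorem map_bind_right {α β γ : Type*} [MeasurableSpace α] [MeasurableSpace β] [MeasurableSpace γ]
    (μ : Measure α) (k : Kernel α β) {f : β → γ} (hf : Measurable f) :
    (μ.bind k).map f = μ.bind (fun a ↦ (k a).map f) := by
  have h := Measure.map_comp μ k hf
  rw [h]
  congr 1
  funext a
  exact Kernel.map_apply _ hf a

/-- **Chapman–Kolmogorov on the state space** (`κ ≤ 4`): `P_{s+t} = P_t ∘ₖ P_s`. [folklore] -/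
theorem angleKernel_add (hκ : κ ≤ 4) (s t : ℝ≥0) :
    angleKernel κ (s + t) = angleKernel κ t ∘ₖ angleKernel κ s := by
  refine Kernel.ext fun x ↦ ?_
  have h1 : angleKernel κ (s + t) x =
      (sleKernel κ s (x : ℝ)).bind fun y ↦ (sleKernel κ t y).map angleProj := by
    rw [angleKernel_apply, sleKernel_add_apply hκ x.2, map_bind_right _ _ measurable_angleProj]
  have h2 : (angleKernel κ t ∘ₖ angleKernel κ s) x =
      (sleKernel κ s (x : ℝ)).bind fun y ↦ angleKernel κ t (angleProj y) := by
    rw [Kernel.comp_apply, angleKernel_apply, bind_map_left measurable_angleProj]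
  rw [h1, h2]
  refine Measure.bind_congr_right ?_
  filter_upwards [ae_sleKernel_mem_Ioo hκ x.2 s] with y hy
  rw [angleKernel_apply]
  have : ((angleProj y : AngleState) : ℝ) = y := by rw [angleProj_val, angleRetract_of_mem hy]
  rw [this]

/-- **Joint measurability** of `(t, x) ↦ P_t(x, ·)` on the state space. [folklore] -/
theorem measurable_angleKernel_uncurry :
    Measurable fun p : ℝ≥0 × AngleState ↦ angleKernel κ p.1 p.2 := by
  refine Measure.measurable_of_measurable_coe _ fun A hA ↦ ?_
  set F : (ℝ≥0 × ℝ) × (ℝ≥0 → ℝ) → AngleState :=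
    angleProj ∘ ((fun q : ℝ≥0 × (ℝ × (ℝ≥0 → ℝ)) ↦ sleArg κ q.2.1 q.1 q.2.2) ∘
      fun q : (ℝ≥0 × ℝ) × (ℝ≥0 → ℝ) ↦ ((q.1.1, (q.1.2, q.2)) : ℝ≥0 × (ℝ × (ℝ≥0 → ℝ)))) with hF
  have hFm : Measurable F :=
    measurable_angleProj.comp ((measurable_sleArg_uncurry₃ κ).comp (by fun_prop))
  have hS : MeasurableSet (F ⁻¹' A) := hFm hA
  have h1 : ∀ p : ℝ≥0 × AngleState, angleKernel κ p.1 p.2 A =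
      preWienerMeasure (Prod.mk (p.1, (p.2 : ℝ)) ⁻¹' (F ⁻¹' A)) := by
    intro p
    rw [angleKernel_apply, Measure.map_apply measurable_angleProj hA,
      sleKernel_apply_set κ p.1 _ (measurable_angleProj hA)]
    congr 1
  have h2 : (fun p : ℝ≥0 × AngleState ↦ angleKernel κ p.1 p.2 A) =
      (fun a : ℝ≥0 × ℝ ↦ preWienerMeasure (Prod.mk a ⁻¹' (F ⁻¹' A))) ∘
        fun p : ℝ≥0 × AngleState ↦ (p.1, (p.2 : ℝ)) := by
    funext p; exact h1 p
  rw [h2]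
  exact (measurable_measure_prodMk_left hS).comp
    (measurable_fst.prodMk (measurable_subtype_coe.comp measurable_snd))

/-- Integration against the state-space kernel: `∫ g d(angleKernel κ t x) = E[(g ∘ proj)(Y^x_t)]`.
[folklore] -/
theorem integral_angleKernel (t : ℝ≥0) (x : AngleState) {g : AngleState → ℝ} (hg : Measurable g) :
    ∫ y, g y ∂(angleKernel κ t x) = ∫ ω, (g ∘ angleProj) (sleArg κ (x : ℝ) t ω) ∂preWienerMeasure := by
  rw [angleKernel_apply, integral_map measurable_angleProj.aemeasurable hg.aestronglyMeasurable]
  exact integral_sleKernel κ t _ (hg.comp measurable_angleProj).aestronglyMeasurable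

/-- **Feller property on the state space** (`κ ≤ 4`): `x ↦ P_t g(x)` is continuous for bounded
continuous `g`. [folklore] -/
theorem continuous_integral_angleKernel (hκ : κ ≤ 4) (t : ℝ≥0) (g : AngleState →ᵇ ℝ) :
    Continuous fun x : AngleState ↦ ∫ y, g y ∂(angleKernel κ t x) := by
  have hgm : Measurable (g : AngleState → ℝ) := g.continuous.measurable
  simp_rw [integral_angleKernel t _ hgm]
  refine continuous_iff_continuousAt.2 fun x ↦ ?_
  rw [ContinuousAt, tendsto_iff_seq_tendsto]
  intro u hu
  have hval : Tendsto (fun m ↦ ((u m : AngleState) : ℝ)) atTop (𝓝 (x : ℝ)) :=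
    (continuous_subtype_val.tendsto x).comp hu
  refine tendsto_integral_sleArg hκ x.2 (fun m ↦ (u m).2) hval t (hgm.comp measurable_angleProj)
    (continuousOn_comp_angleProj g.continuous) (C := ‖g‖) fun y ↦ ?_
  rw [← Real.norm_eq_abs]
  exact g.norm_coe_le_norm _

end Kernels

/-! ### The Lyapunov function on the state space -/

section Lyapunov

/-- **The coercive Lyapunov function** `V(x) = (1 - log sin(x/2))^{1/2}` on the state space,
`ℝ≥0`-valued. [folklore] -/
def lyapV (x : AngleState) : ℝ≥0 :=
  ⟨Real.sqrt (1 - Real.log (Real.sin ((x : ℝ) / 2))), sqrtLyap_nonneg _⟩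

/-- Value of the Lyapunov function. [folklore] -/
theorem coe_lyapV (x : AngleState) :
    (lyapV x : ℝ) = Real.sqrt (1 - Real.log (Real.sin ((x : ℝ) / 2))) := rfl

/-- The Lyapunov function is continuous on the state space. [folklore] -/
theorem continuous_lyapV : Continuous lyapV := by
  have h : Continuous fun x : AngleState ↦ Real.sqrt (1 - Real.log (Real.sin ((x : ℝ) / 2))) :=
    continuousOn_sqrtLyap.comp_continuous continuous_subtype_val fun x ↦ x.2
  exact continuous_induced_rng.2 (by exact h)

/-- The Lyapunov function read through the projection is dominated by `V` on all of `ℝ` (off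
`(0, 2π)` the projection is `π`, where `V = 1 ≤ V(y)`). [folklore] -/
theorem lyapV_angleProj_le (y : ℝ) :
    (lyapV (angleProj y) : ℝ) ≤ Real.sqrt (1 - Real.log (Real.sin (y / 2))) := by
  rw [coe_lyapV, angleProj_val]
  by_cases h : y ∈ Ioo 0 (2 * Real.pi)
  · rw [angleRetract_of_mem h]
  · unfold angleRetract
    rw [if_neg h, Real.sin_pi_div_two, Real.log_one, sub_zero, Real.sqrt_one]
    exact one_le_sqrtLyap y

/-- **The sublevel sets of `V` are compact** in the open interval (`V → ∞` at both ends).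
[folklore] -/
theorem isCompact_lyapV_le (R : ℝ≥0) : IsCompact {x : AngleState | lyapV x ≤ R} := by
  obtain ⟨ε, hε, hsub⟩ := exists_sqrtLyap_sublevel_subset_Icc (R : ℝ)
  -- the compact `val⁻¹' [ε, 2π - ε]`
  have hK : IsCompact ((Subtype.val : AngleState → ℝ) ⁻¹' Icc ε (2 * Real.pi - ε)) := by
    rw [Topology.IsInducing.subtypeVal.isCompact_iff, Subtype.image_preimage_coe]
    by_cases hε' : ε ≤ 2 * Real.pi - ε
    · have : Ioo 0 (2 * Real.pi) ∩ Icc ε (2 * Real.pi - ε) = Icc ε (2 * Real.pi - ε) :=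
        inter_eq_right.2 (Icc_subset_Ioo hε (by linarith))
      rw [this]; exact isCompact_Icc
    · rw [Icc_eq_empty hε', inter_empty]; exact isCompact_empty
  refine hK.of_isClosed_subset (isClosed_le continuous_lyapV continuous_const) fun x hx ↦ ?_
  have hx' : Real.sqrt (1 - Real.log (Real.sin ((x : ℝ) / 2))) ≤ R := by
    have := hx; simp only [mem_setOf_eq, ← NNReal.coe_le_coe, coe_lyapV] at this; exact this
  exact hsub _ x.2 hx'

variable {κ : ℝ≥0}

/-- **Uniform moment bound along every orbit** (`0 < κ ≤ 4`):
`∫ V d(P_t(z, ·)) ≤ V(z) + C_κ`. [cite: MillerSheffield2013, Prop. 2.1] -/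
theorem lintegral_lyapV_angleKernel_le (hκ0 : 0 < κ) (hκ : κ ≤ 4) (z : AngleState) (t : ℝ≥0) :
    ∫⁻ y, (lyapV y : ℝ≥0∞) ∂(angleKernel κ t z) ≤
      ENNReal.ofReal (Real.sqrt (1 - Real.log (Real.sin ((z : ℝ) / 2))) +
        (40 + (κ : ℝ) + 10000 / κ) / 32) := by
  rw [angleKernel_apply, lintegral_map (continuous_lyapV.measurable.coe_nnreal_ennreal)
    measurable_angleProj]
  have h := lintegral_sleKernel κ t (z : ℝ) (g := fun y ↦ ((lyapV (angleProj y) : ℝ≥0) : ℝ≥0∞))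
    ((continuous_lyapV.measurable.coe_nnreal_ennreal).comp measurable_angleProj)
  rw [h]
  refine le_trans (lintegral_mono fun ω ↦ ?_) (lintegral_sqrtLyap_sleArg_le hκ0 hκ z.2 t)
  rw [← ENNReal.ofReal_coe_nnreal]
  exact ENNReal.ofReal_le_ofReal (lyapV_angleProj_le _)

end Lyapunov

/-! ### Existence of an invariant probability measure -/

section Existence

variable {κ : ℝ≥0}

/-- **Krylov–Bogoliubov on the state space**: for `0 < κ ≤ 4` there is a probability measure on
`(0, 2π)` invariant under all the kernels `angleKernel κ t`. [cite: DapratoZabczyk1996, Thm 3.1.1] -/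
theorem exists_invariant_angleKernel (hκ0 : 0 < κ) (hκ : κ ≤ 4) :
    ∃ μ : Measure AngleState, IsProbabilityMeasure μ ∧ ∀ t, Kernel.Invariant (angleKernel κ t) μ := by
  set z : AngleState := ⟨Real.pi, pi_mem_Ioo_twoPi⟩
  set C : Unit → ℝ≥0∞ := fun _ ↦ ENNReal.ofReal (Real.sqrt (1 - Real.log (Real.sin ((z : ℝ) / 2))) +
    (40 + (κ : ℝ) + 10000 / κ) / 32)
  obtain ⟨μ, hμ, hinv, -⟩ := MarkovSemigroup.exists_invariant_of_bounded_orbit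
    (X := AngleState) (fun t ↦ angleKernel κ t) (angleKernel_add hκ)
    measurable_angleKernel_uncurry (continuous_integral_angleKernel hκ)
    (fun _ : Unit ↦ lyapV) (fun _ ↦ continuous_lyapV) C z
    (fun _ t ↦ lintegral_lyapV_angleKernel_le hκ0 hκ z t) () ENNReal.ofReal_ne_top
    isCompact_lyapV_le
  exact ⟨μ, hμ, hinv⟩

/-- **Existence of an invariant probability measure for the SLE_κ radial Bessel kernels**
(`0 < κ ≤ 4`): a probability measure `μ` on `ℝ`, carried by `(0, 2π)`, with `μ P_t = μ` for every
`t ≥ 0` — the one-dimensional marginal of the stationary SLE_κ(0) angle process of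
Miller–Sheffield (2013), Prop. 2.1, obtained here by the Krylov–Bogoliubov theorem from the
Lyapunov moment bound of `RadialBesselLyapunov`. [cite: MillerSheffield2013, Prop. 2.1] -/
theorem exists_invariant_sleKernel (hκ0 : 0 < κ) (hκ : κ ≤ 4) :
    ∃ μ : Measure ℝ, IsProbabilityMeasure μ ∧ (∀ᵐ y ∂μ, y ∈ Ioo 0 (2 * Real.pi)) ∧
      ∀ t, μ.bind (sleKernel κ t) = μ := by
  obtain ⟨μ, hμ, hinv⟩ := exists_invariant_angleKernel hκ0 hκ
  refine ⟨μ.map Subtype.val, Measure.isProbabilityMeasure_map measurable_subtype_coe.aemeasurable,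
    ?_, fun t ↦ ?_⟩
  · exact (ae_map_iff measurable_subtype_coe.aemeasurable measurableSet_Ioo).2
      (ae_of_all _ fun x ↦ x.2)
  · rw [bind_map_left measurable_subtype_coe]
    conv_rhs => rw [← (hinv t).def, map_bind_right _ _ measurable_subtype_coe]
    congr 1
    funext x
    exact (map_val_angleKernel hκ t x).symm

end Existence

/-! ### Uniqueness of the invariant probability measure -/

section Uniqueness

variable {κ : ℝ≥0}

/-- Under an invariant measure, `∫ g dμ = ∫ P_t g dμ` for bounded measurable `g`. [folklore] -/
theorem integral_eq_integral_integral_sleArg_of_invariant {μ : Measure ℝ} [IsProbabilityMeasure μ]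
    {t : ℝ≥0} (hinv : μ.bind (sleKernel κ t) = μ) {g : ℝ → ℝ} (hg : Measurable g) {C : ℝ}
    (hgb : ∀ y, |g y| ≤ C) :
    ∫ y, g y ∂μ = ∫ θ, (∫ ω, g (sleArg κ θ t ω) ∂preWienerMeasure) ∂μ := by
  conv_lhs => rw [← hinv]
  have hint : Integrable g (μ.bind (sleKernel κ t)) := by
    rw [hinv]
    exact (integrable_const C).mono' hg.aestronglyMeasurable
      (Eventually.of_forall fun y ↦ by rw [Real.norm_eq_abs]; exact hgb y)
  change ∫ y, g y ∂(sleKernel κ t ∘ₘ μ) = _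
  rw [Measure.comp_eq_comp_const_apply] at hint ⊢
  rw [Kernel.integral_comp hint, Kernel.const_apply]
  refine integral_congr_ae (ae_of_all _ fun θ ↦ ?_)
  exact integral_sleKernel κ t θ hg.aestronglyMeasurable

/-- On a probability space an a.e. bound on the integrand bounds the integral. [folklore] -/
theorem norm_integral_le_of_ae_le {α : Type*} [MeasurableSpace α] {μ : Measure α}
    [IsProbabilityMeasure μ] {f : α → ℝ} {C : ℝ} (h : ∀ᵐ x ∂μ, ‖f x‖ ≤ C) :
    ‖∫ x, f x ∂μ‖ ≤ C :=
  (norm_integral_le_of_norm_le_const h).trans_eq (by rw [probReal_univ, mul_one])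

/-- **Equality of integrals of bounded Lipschitz observables under two invariant measures**
(`κ ≤ 4`; synchronous-coupling contraction and `t → ∞`). [cite: MillerSheffield2013, Prop. 2.1] -/
theorem integral_eq_of_invariant (hκ : κ ≤ 4) {μ₁ μ₂ : Measure ℝ} [IsProbabilityMeasure μ₁]
    [IsProbabilityMeasure μ₂] (h₁ : ∀ᵐ y ∂μ₁, y ∈ Ioo 0 (2 * Real.pi))
    (h₂ : ∀ᵐ y ∂μ₂, y ∈ Ioo 0 (2 * Real.pi)) (hinv₁ : ∀ t, μ₁.bind (sleKernel κ t) = μ₁)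
    (hinv₂ : ∀ t, μ₂.bind (sleKernel κ t) = μ₂) {g : ℝ → ℝ} (hg : Measurable g) {C : ℝ}
    (hgb : ∀ y, |g y| ≤ C) {L : ℝ≥0} (hgL : LipschitzWith L g) :
    ∫ y, g y ∂μ₁ = ∫ y, g y ∂μ₂ := by
  haveI := isProbabilityMeasure_preWienerMeasure'
  -- `P_t g`
  set Pg : ℝ≥0 → ℝ → ℝ := fun t θ ↦ ∫ ω, g (sleArg κ θ t ω) ∂preWienerMeasure with hPg
  have hPgm : ∀ t, Measurable (Pg t) := fun t ↦ measurable_integral_sleArg t hg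
  have hC0 : 0 ≤ C := (abs_nonneg _).trans (hgb 0)
  have hPgb : ∀ t θ, |Pg t θ| ≤ C := fun t θ ↦ by
    rw [← Real.norm_eq_abs]
    refine norm_integral_le_of_ae_le (ae_of_all _ fun ω ↦ ?_)
    rw [Real.norm_eq_abs]; exact hgb _
  -- the difference at time `t`
  have hdiff : ∀ t : ℝ≥0, |∫ y, g y ∂μ₁ - ∫ y, g y ∂μ₂| ≤
      L * (2 * Real.pi) * Real.exp (-(t : ℝ) / 2) := by
    intro t
    rw [integral_eq_integral_integral_sleArg_of_invariant (hinv₁ t) hg hgb,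
      integral_eq_integral_integral_sleArg_of_invariant (hinv₂ t) hg hgb]
    change |∫ θ, Pg t θ ∂μ₁ - ∫ θ', Pg t θ' ∂μ₂| ≤ _
    have hint1 : Integrable (Pg t) μ₁ := (integrable_const C).mono' (hPgm t).aestronglyMeasurable
      (Eventually.of_forall fun y ↦ by rw [Real.norm_eq_abs]; exact hPgb t y)
    have hint2 : Integrable (Pg t) μ₂ := (integrable_const C).mono' (hPgm t).aestronglyMeasurable
      (Eventually.of_forall fun y ↦ by rw [Real.norm_eq_abs]; exact hPgb t y)
    -- write the difference as a double integral
    have e1 : ∫ θ, Pg t θ ∂μ₁ - ∫ θ', Pg t θ' ∂μ₂ = ∫ θ, (Pg t θ - ∫ θ', Pg t θ' ∂μ₂) ∂μ₁ := by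
      rw [integral_sub hint1 (integrable_const _), integral_const, probReal_univ, one_smul]
    have e2 : ∀ θ, Pg t θ - ∫ θ', Pg t θ' ∂μ₂ = ∫ θ', (Pg t θ - Pg t θ') ∂μ₂ := fun θ ↦ by
      rw [integral_sub (integrable_const _) hint2, integral_const, probReal_univ, one_smul]
    rw [e1]
    simp_rw [e2]
    set K : ℝ := L * (2 * Real.pi) * Real.exp (-(t : ℝ) / 2) with hK
    have hK0 : 0 ≤ K := by positivity
    -- inner bound, for a.e. `θ`
    have hinner : ∀ᵐ θ ∂μ₁, ‖∫ θ', (Pg t θ - Pg t θ') ∂μ₂‖ ≤ K := by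
      filter_upwards [h₁] with θ hθ
      refine norm_integral_le_of_ae_le ?_
      filter_upwards [h₂] with θ' hθ'
      rw [Real.norm_eq_abs]
      refine (abs_integral_sleArg_sub_le hκ hθ hθ' t hg hgb hgL).trans ?_
      have hθθ' : |θ - θ'| ≤ 2 * Real.pi := by
        rw [abs_sub_le_iff]; constructor <;> linarith [hθ.1, hθ.2, hθ'.1, hθ'.2]
      have := mul_le_mul_of_nonneg_left hθθ' (NNReal.coe_nonneg L)
      exact mul_le_mul_of_nonneg_right this (Real.exp_pos _).le
    rw [← Real.norm_eq_abs]
    exact norm_integral_le_of_ae_le hinner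
  -- let `t → ∞`
  have hlim : Tendsto (fun t : ℝ≥0 ↦ L * (2 * Real.pi) * Real.exp (-(t : ℝ) / 2)) atTop (𝓝 0) := by
    have h1 : Tendsto (fun t : ℝ≥0 ↦ Real.exp (-(t : ℝ) / 2)) atTop (𝓝 0) := by
      refine Real.tendsto_exp_atBot.comp ?_
      have h0 : Tendsto (fun t : ℝ≥0 ↦ (t : ℝ)) atTop atTop := NNReal.tendsto_coe_atTop.2 tendsto_id
      have h2 : Tendsto (fun t : ℝ≥0 ↦ -(t : ℝ) / 2) atTop atBot :=
        (tendsto_neg_atTop_atBot.comp h0).atBot_div_const (by norm_num)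
      exact h2
    simpa using h1.const_mul (L * (2 * Real.pi))
  have h0 : |∫ y, g y ∂μ₁ - ∫ y, g y ∂μ₂| ≤ 0 :=
    ge_of_tendsto' hlim fun t ↦ hdiff t
  exact sub_eq_zero.1 (abs_nonpos_iff.1 h0)

/-- The Lipschitz ramps `gₙ(x) = 1 ∧ (n(a - x) + 1)⁺` decreasing to `𝟙_{(-∞, a]}`. [folklore] -/
theorem lipschitzWith_ramp (n : ℕ) (a : ℝ) :
    LipschitzWith (n : ℝ≥0) fun x : ℝ ↦ min 1 (max 0 ((n : ℝ) * (a - x) + 1)) := by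
  refine LipschitzWith.of_dist_le_mul fun x y ↦ ?_
  rw [Real.dist_eq, Real.dist_eq]
  have h1 : |min 1 (max 0 ((n : ℝ) * (a - x) + 1)) - min 1 (max 0 ((n : ℝ) * (a - y) + 1))| ≤
      |max 0 ((n : ℝ) * (a - x) + 1) - max 0 ((n : ℝ) * (a - y) + 1)| := by
    have := abs_min_sub_min_le_max (1 : ℝ) (max 0 ((n : ℝ) * (a - x) + 1)) 1 (max 0 ((n : ℝ) * (a - y) + 1))
    simpa using this
  have h2 : |max 0 ((n : ℝ) * (a - x) + 1) - max 0 ((n : ℝ) * (a - y) + 1)| ≤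
      |((n : ℝ) * (a - x) + 1) - ((n : ℝ) * (a - y) + 1)| := by
    have := abs_max_sub_max_le_max (0 : ℝ) ((n : ℝ) * (a - x) + 1) 0 ((n : ℝ) * (a - y) + 1)
    simpa using this
  refine (h1.trans h2).trans_eq ?_
  rw [show (n : ℝ) * (a - x) + 1 - ((n : ℝ) * (a - y) + 1) = (n : ℝ) * (y - x) by ring, abs_mul,
    Nat.abs_cast, abs_sub_comm]
  rfl

/-- The ramps lie in `[0, 1]`. [folklore] -/
theorem ramp_mem_Icc (n : ℕ) (a x : ℝ) : min 1 (max 0 ((n : ℝ) * (a - x) + 1)) ∈ Icc (0 : ℝ) 1 :=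
  ⟨le_min zero_le_one (le_max_left _ _), min_le_left _ _⟩

/-- The ramps converge to the indicator of `(-∞, a]`. [folklore] -/
theorem tendsto_ramp (a x : ℝ) :
    Tendsto (fun n : ℕ ↦ min 1 (max 0 ((n : ℝ) * (a - x) + 1))) atTop
      (𝓝 ((Iic a).indicator (1 : ℝ → ℝ) x)) := by
  by_cases hx : x ≤ a
  · rw [indicator_of_mem (show x ∈ Iic a from hx)]
    refine tendsto_const_nhds.congr fun n ↦ ?_
    have : (1 : ℝ) ≤ (n : ℝ) * (a - x) + 1 := by nlinarith [sub_nonneg.2 hx, (Nat.cast_nonneg n : (0 : ℝ) ≤ n)]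
    rw [max_eq_right (zero_le_one.trans this), min_eq_left this, Pi.one_apply]
  · rw [indicator_of_notMem (show x ∉ Iic a from hx)]
    have hax : a - x < 0 := by linarith [not_le.1 hx]
    have h1 : Tendsto (fun n : ℕ ↦ (n : ℝ) * (a - x) + 1) atTop atBot :=
      tendsto_atBot_add_const_right _ _ (tendsto_natCast_atTop_atTop.atTop_mul_const_of_neg hax)
    refine tendsto_const_nhds.congr' ?_
    filter_upwards [h1.eventually (eventually_le_atBot 0)] with n hn
    rw [max_eq_left hn, min_eq_right zero_le_one]

/-- **Uniqueness of the invariant probability measure of the SLE_κ radial Bessel kernels**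
(`κ ≤ 4`): two invariant probability measures carried by `(0, 2π)` are equal (contraction of the
synchronous coupling, Miller–Sheffield (2013), §2.1.2 (2.5) and Prop. 2.1).
[cite: MillerSheffield2013, Prop. 2.1] -/
theorem invariant_sleKernel_unique (hκ : κ ≤ 4) {μ₁ μ₂ : Measure ℝ} [IsProbabilityMeasure μ₁]
    [IsProbabilityMeasure μ₂] (h₁ : ∀ᵐ y ∂μ₁, y ∈ Ioo 0 (2 * Real.pi))
    (h₂ : ∀ᵐ y ∂μ₂, y ∈ Ioo 0 (2 * Real.pi)) (hinv₁ : ∀ t, μ₁.bind (sleKernel κ t) = μ₁)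
    (hinv₂ : ∀ t, μ₂.bind (sleKernel κ t) = μ₂) : μ₁ = μ₂ := by
  refine Measure.ext_of_Iic μ₁ μ₂ fun a ↦ ?_
  set r : ℕ → ℝ → ℝ := fun n x ↦ min 1 (max 0 ((n : ℝ) * (a - x) + 1)) with hr
  have hrm : ∀ n, Measurable (r n) := fun n ↦ (lipschitzWith_ramp n a).continuous.measurable
  have hrb : ∀ n x, |r n x| ≤ 1 := fun n x ↦ by
    rw [abs_le]; exact ⟨by linarith [(ramp_mem_Icc n a x).1], (ramp_mem_Icc n a x).2⟩
  have heq : ∀ n, ∫ x, r n x ∂μ₁ = ∫ x, r n x ∂μ₂ := fun n ↦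
    integral_eq_of_invariant hκ h₁ h₂ hinv₁ hinv₂ (hrm n) (hrb n) (lipschitzWith_ramp n a)
  -- dominated convergence on both sides
  have hlim : ∀ (μ : Measure ℝ) [IsProbabilityMeasure μ],
      Tendsto (fun n ↦ ∫ x, r n x ∂μ) atTop (𝓝 (μ.real (Iic a))) := by
    intro μ _
    have h := tendsto_integral_of_dominated_convergence (fun _ ↦ (1 : ℝ))
      (fun n ↦ (hrm n).aestronglyMeasurable) (integrable_const 1)
      (fun n ↦ ae_of_all _ fun x ↦ by rw [Real.norm_eq_abs]; exact hrb n x)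
      (ae_of_all μ fun x ↦ tendsto_ramp a x)
    rwa [integral_indicator_one measurableSet_Iic] at h
  have h := tendsto_nhds_unique (hlim μ₁) ((hlim μ₂).congr fun n ↦ (heq n).symm)
  have h' : (μ₁ (Iic a)).toReal = (μ₂ (Iic a)).toReal := h
  exact (ENNReal.toReal_eq_toReal_iff' (measure_ne_top _ _) (measure_ne_top _ _)).1 h'

end Uniqueness

end RadialLoewner

end Literature.Probability.RandomPlanarGeometry
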